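import Mathlib
import Literature.InformationTheory.Coding.DelsarteLPBound
import HarnessLib

/-!
# The MacWilliams identity for binary linear codes

Topic `Literature/InformationTheory/Coding`. MacWilliams' theorem [MacWilliamsSloane1977, Ch. 5 §2
Thm. 1, eqs. (4)–(6)]: the weight enumerator of the dual `C⊥` of a binary linear code `C` of
length `n` is `W_{C⊥}(x, y) = |C|⁻¹ · W_C(x + y, x - y)`; its weight-distribution (Krawtchouk) form
`A'_k = |C|⁻¹ Σ_i A_i K_k(i)` [eq. (13)]; the character-sum lemma it rests on [Lemma 2, eq. (8),
with the Hadamard transform (7) and the evaluation (11)]; and the corollaries `|C| · |C⊥| = 2^n`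
[Ch. 1 §8: `C⊥` is an `[n, n - k]` code] and `(C⊥)⊥ = C` [Ch. 1 §8 Problem (33)(a)].

Binary words are `Fin n → Bool`, as in `DelsarteLPBound`, whose characters `signChar` and
Krawtchouk values `krawtchouk` are reused. A binary *linear* code is a nonempty `Finset` of words
closed under the coordinatewise sum `(u + v)_i = (u_i != v_i)` (a subspace of `F^n`, `F = GF(2)`
[Ch. 1 §2]); the dual code is cut out by the `±1`-valued characters `dotSign u v = (-1)^{u·v}`
[Ch. 1 §8 (41), (42); Ch. 5 §2 (7)]. Every identity is stated cleared of the denominator `|C|`,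
and Theorem 1 is stated for elements `x, y` of an arbitrary commutative ring `R`, which contains the
polynomial identity as the case `R = ℤ[x, y]`.

Contents:
* `wt`, `dotSign`, `IsLinearCode`, `perpCode C = C⊥`, `weightCount C i = A_i` [Ch. 5 §2 (1), (3)].
* `sum_dotSign_eq` — `Σ_{u ∈ C} (-1)^{u·v} = |C| · [v ∈ C⊥]` [Ch. 5 §2, proof of Lemma 2].
* `hadamardTransform`, `sum_hadamardTransform_eq` — Lemma 2 / eq. (8) (times `|C|`).
* `hadamardTransform_weightMonomial` — eq. (11).
* `macwilliams_identity` — Thm. 1, eq. (6) times `|C|`; `macwilliams_identity_weightCount` —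
  eq. (5) times `|C|`.
* `card_mul_weightCount_perpCode_eq` — eq. (13) times `|C|`:
  `|C| · A'_k = Σ_i A_i K_k(i) = Σ_{u ∈ C} K_k(wt u)`.
* `card_mul_card_perpCode` — `|C| · |C⊥| = 2^n`; `isLinearCode_perpCode`; `perpCode_perpCode` —
  `(C⊥)⊥ = C`.
* Worked example [Ch. 5 §2 Example (ii)]: the self-dual code `{00, 11}`.

References. [MacWilliamsSloane1977] F. J. MacWilliams, N. J. A. Sloane, *The Theory of
Error-Correcting Codes*, North-Holland 1977 — Ch. 1 §8 ((41), (42), Problem (33)); Ch. 5 §2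
((1), (3), Thm. 1 with (4)–(6), (7), Lemma 2 (8), (11), (12), (13), Example (ii)).
-/

open Finset

namespace Literature.InformationTheory.Coding

variable {n : ℕ}

/-! ## 1. Weight and the characters `(-1)^{u·v}` -/

/-- The Hamming weight `wt(u) = #{i : u_i = 1}` of a binary word.
[cite: MacWilliamsSloane1977, Ch. 5 §2 eq. (1)] -/
def wt (u : Fin n → Bool) : ℕ := #{i | u i = true}

/-- `wt(u) ≤ n`. [cite: MacWilliamsSloane1977, Ch. 5 §2 eq. (1)] -/
theorem wt_le (u : Fin n → Bool) : wt u ≤ n :=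
  (card_filter_le _ _).trans (by simp)

/-- The number of zero coordinates is `n - wt(u)`. [cite: MacWilliamsSloane1977, Ch. 5 §2 eq. (1)] -/
theorem card_filter_not_eq_sub_wt (u : Fin n → Bool) : #{i | ¬ u i = true} = n - wt u := by
  have h := Finset.card_filter_add_card_filter_not (s := (univ : Finset (Fin n)))
    (fun i => u i = true)
  simp only [card_univ, Fintype.card_fin] at h
  unfold wt
  omega

/-- Only the zero word has weight `0`. [cite: MacWilliamsSloane1977, Ch. 5 §2 eq. (1)] -/
theorem wt_eq_zero_iff (u : Fin n → Bool) : wt u = 0 ↔ u = fun _ => false := by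
  unfold wt
  rw [Finset.card_eq_zero, Finset.filter_eq_empty_iff]
  constructor
  · intro h
    funext i
    simpa using h (mem_univ i)
  · rintro rfl
    simp

/-- The character `(-1)^{u·v}` of `F^n`, `u · v = Σ u_i v_i` the scalar product over `GF(2)`:
it is `signChar (supp u) v = ∏_{i : u_i = 1} (-1)^{v_i}`.
[cite: MacWilliamsSloane1977, Ch. 1 §8 eq. (41); Ch. 5 §2 eq. (7)] -/
def dotSign (u v : Fin n → Bool) : ℤ := signChar (univ.filter fun i => u i = true) v

/-- `(-1)^{u·v} = ∏_i (-1)^{u_i v_i}`. [cite: MacWilliamsSloane1977, Ch. 1 §8 eq. (41)] -/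
theorem dotSign_eq_prod (u v : Fin n → Bool) :
    dotSign u v = ∏ i, if (u i && v i) = true then (-1 : ℤ) else 1 := by
  unfold dotSign signChar
  rw [Finset.prod_filter]
  refine prod_congr rfl fun i _ => ?_
  cases u i <;> cases v i <;> simp [bitSign]

/-- The scalar product is symmetric: `(-1)^{u·v} = (-1)^{v·u}`.
[cite: MacWilliamsSloane1977, Ch. 1 §8 eq. (41)] -/
theorem dotSign_comm (u v : Fin n → Bool) : dotSign u v = dotSign v u := by
  rw [dotSign_eq_prod, dotSign_eq_prod]
  exact prod_congr rfl fun i _ => by rw [Bool.and_comm]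

/-- `((-1)^{u·v})² = 1`. [cite: MacWilliamsSloane1977, Ch. 5 §2 eq. (7)] -/
theorem dotSign_mul_self (u v : Fin n → Bool) : dotSign u v * dotSign u v = 1 :=
  signChar_mul_self _ _

/-- `(-1)^{u·v} = ±1`. [cite: MacWilliamsSloane1977, Ch. 5 §2 eq. (7)] -/
theorem dotSign_eq_one_or (u v : Fin n → Bool) : dotSign u v = 1 ∨ dotSign u v = -1 :=
  mul_self_eq_one_iff.mp (dotSign_mul_self u v)

/-- Additivity in the second argument: `(-1)^{u·(v+w)} = (-1)^{u·v} (-1)^{u·w}`.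
[cite: MacWilliamsSloane1977, Ch. 1 §8 eq. (41)] -/
theorem dotSign_add_right (u v w : Fin n → Bool) :
    dotSign u (fun i => v i != w i) = dotSign u v * dotSign u w :=
  (signChar_mul_signChar _ _ _).symm

/-- Additivity in the first argument: `(-1)^{(u+v)·w} = (-1)^{u·w} (-1)^{v·w}`.
[cite: MacWilliamsSloane1977, Ch. 1 §8 eq. (41)] -/
theorem dotSign_add_left (u v w : Fin n → Bool) :
    dotSign (fun i => u i != v i) w = dotSign u w * dotSign v w := by
  rw [dotSign_comm, dotSign_add_right, dotSign_comm w u, dotSign_comm w v]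

/-- `(-1)^{u·0} = 1`. [cite: MacWilliamsSloane1977, Ch. 1 §8 eq. (41)] -/
theorem dotSign_zero_right (u : Fin n → Bool) : dotSign u (fun _ => false) = 1 := by
  simp [dotSign_eq_prod]

/-! ## 2. Binary linear codes and the dual code -/

/-- A binary *linear code* of length `n`: a nonempty set of words closed under the coordinatewise
sum over `GF(2)`, i.e. a subspace of `F^n`. [cite: MacWilliamsSloane1977, Ch. 1 §2; Ch. 5 §2
Thm. 1 ("[n, k] binary linear code")] -/
def IsLinearCode (C : Finset (Fin n → Bool)) : Prop :=
  C.Nonempty ∧ ∀ u ∈ C, ∀ v ∈ C, (fun i => u i != v i) ∈ C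

/-- A linear code contains the zero word (`u + u = 0`). [cite: MacWilliamsSloane1977, Ch. 1 §2] -/
theorem IsLinearCode.zero_mem {C : Finset (Fin n → Bool)} (hC : IsLinearCode C) :
    (fun _ => false) ∈ C := by
  obtain ⟨u, hu⟩ := hC.1
  have h := hC.2 u hu u hu
  simpa using h

/-- The dual code `C⊥ = {v : u · v = 0 for all u ∈ C}`, i.e. `(-1)^{u·v} = 1` for all `u ∈ C`.
[cite: MacWilliamsSloane1977, Ch. 1 §8 eq. (42)] -/
def perpCode (C : Finset (Fin n → Bool)) : Finset (Fin n → Bool) :=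
  univ.filter fun v => ∀ u ∈ C, dotSign u v = 1

/-- Membership in `C⊥`. [cite: MacWilliamsSloane1977, Ch. 1 §8 eq. (42)] -/
theorem mem_perpCode {C : Finset (Fin n → Bool)} {v : Fin n → Bool} :
    v ∈ perpCode C ↔ ∀ u ∈ C, dotSign u v = 1 := by
  simp [perpCode]

/-- `0 ∈ C⊥`. [cite: MacWilliamsSloane1977, Ch. 1 §8 eq. (42)] -/
theorem zero_mem_perpCode (C : Finset (Fin n → Bool)) : (fun _ => false) ∈ perpCode C :=
  mem_perpCode.mpr fun u _ => dotSign_zero_right u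

/-- `C⊥` is a linear code (for any set of words `C`). [cite: MacWilliamsSloane1977, Ch. 1 §8
("`C⊥` is an [n, n-k] code")] -/
theorem isLinearCode_perpCode (C : Finset (Fin n → Bool)) : IsLinearCode (perpCode C) :=
  ⟨⟨_, zero_mem_perpCode C⟩, fun v hv w hw => mem_perpCode.mpr fun u hu => by
    rw [dotSign_add_right, mem_perpCode.mp hv u hu, mem_perpCode.mp hw u hu, mul_one]⟩

/-- `C ⊆ (C⊥)⊥`. [cite: MacWilliamsSloane1977, Ch. 1 §8 Problem (33)(a)] -/
theorem subset_perpCode_perpCode (C : Finset (Fin n → Bool)) : C ⊆ perpCode (perpCode C) :=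
  fun v hv => mem_perpCode.mpr fun u hu => by
    rw [dotSign_comm]
    exact mem_perpCode.mp hu v hv

/-- The weight distribution `A_i = #{u ∈ C : wt(u) = i}`.
[cite: MacWilliamsSloane1977, Ch. 5 §2 eq. (1)] -/
def weightCount (C : Finset (Fin n → Bool)) (i : ℕ) : ℕ := #{u ∈ C | wt u = i}

/-- Regrouping a sum over a code by weight: `Σ_{u ∈ C} g(wt u) = Σ_{i=0}^{n} A_i · g(i)` (the two
ways of writing a weight enumerator). [cite: MacWilliamsSloane1977, Ch. 5 §2 eq. (1)] -/
theorem sum_eq_sum_weightCount {M : Type*} [AddCommMonoid M] (C : Finset (Fin n → Bool))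
    (g : ℕ → M) : ∑ u ∈ C, g (wt u) = ∑ i ∈ range (n + 1), weightCount C i • g i := by
  rw [← Finset.sum_fiberwise_of_maps_to (s := C) (t := range (n + 1)) (g := wt)
    (fun u _ => mem_range.mpr (Nat.lt_succ_of_le (wt_le u)))]
  refine sum_congr rfl fun i _ => ?_
  rw [sum_congr rfl (fun u hu => by rw [(mem_filter.mp hu).2] :
    ∀ u ∈ C.filter (fun u => wt u = i), g (wt u) = g i), sum_const]
  rfl

/-! ## 3. The character sum over a linear code -/

/-- **Orthogonality of characters on a linear code.** For a binary linear code `C` and any word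
`v`: `Σ_{u ∈ C} (-1)^{u·v} = |C|` if `v ∈ C⊥` and `= 0` otherwise (if `v ∉ C⊥`, `u · v` takes the
values `0` and `1` equally often on `C`: translating by a `u₀ ∈ C` with `u₀ · v = 1` negates the
sum). [cite: MacWilliamsSloane1977, Ch. 5 §2, proof of Lemma 2] -/
theorem sum_dotSign_eq {C : Finset (Fin n → Bool)} (hC : IsLinearCode C) (v : Fin n → Bool) :
    ∑ u ∈ C, dotSign u v = if v ∈ perpCode C then (#C : ℤ) else 0 := by
  split_ifs with hv
  · rw [mem_perpCode] at hv
    rw [sum_congr rfl hv]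
    simp
  · rw [mem_perpCode] at hv
    obtain ⟨u₀, hu₀, hne⟩ : ∃ u₀ ∈ C, dotSign u₀ v ≠ 1 := by
      by_contra hcon
      exact hv fun u hu => by
        by_contra h1
        exact hcon ⟨u, hu, h1⟩
    have hneg : dotSign u₀ v = -1 := (dotSign_eq_one_or u₀ v).resolve_left hne
    have hbij : ∑ u ∈ C, dotSign (fun i => u i != u₀ i) v = ∑ u ∈ C, dotSign u v :=
      Finset.sum_bij' (fun u _ => fun i => u i != u₀ i) (fun u _ => fun i => u i != u₀ i)
        (fun u hu => hC.2 u hu u₀ hu₀) (fun u hu => hC.2 u hu u₀ hu₀)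
        (fun u _ => by funext i; dsimp only; cases u i <;> cases u₀ i <;> rfl)
        (fun u _ => by funext i; dsimp only; cases u i <;> cases u₀ i <;> rfl)
        (fun u _ => rfl)
    have hflip : ∑ u ∈ C, dotSign (fun i => u i != u₀ i) v = -∑ u ∈ C, dotSign u v := by
      rw [← sum_neg_distrib]
      refine sum_congr rfl fun u _ => ?_
      rw [dotSign_add_left, hneg]
      ring
    linarith

/-! ## 4. Lemma 2: the Hadamard transform summed over a code -/

section Hadamard

variable {M : Type*} [AddCommGroup M]

/-- The Hadamard transform `f̂(u) = Σ_{v ∈ F^n} (-1)^{u·v} f(v)` of a function `f` on `F^n` with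
values in an abelian group. [cite: MacWilliamsSloane1977, Ch. 5 §2 eq. (7)] -/
def hadamardTransform (f : (Fin n → Bool) → M) (u : Fin n → Bool) : M :=
  ∑ v, dotSign u v • f v

/-- **Lemma 2** (cleared of the denominator): for a binary linear code `C`,
`Σ_{u ∈ C} f̂(u) = |C| · Σ_{v ∈ C⊥} f(v)`. [cite: MacWilliamsSloane1977, Ch. 5 §2 Lemma 2 eq. (8)] -/
theorem sum_hadamardTransform_eq {C : Finset (Fin n → Bool)} (hC : IsLinearCode C)
    (f : (Fin n → Bool) → M) :
    ∑ u ∈ C, hadamardTransform f u = (#C : ℤ) • ∑ v ∈ perpCode C, f v := by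
  unfold hadamardTransform
  rw [sum_comm]
  simp_rw [← Finset.sum_smul, sum_dotSign_eq hC, ite_smul, zero_smul]
  rw [← Finset.sum_filter, Finset.smul_sum]
  have hfilter : (univ.filter fun v => v ∈ perpCode C) = perpCode C := by
    ext v
    simp
  rw [hfilter]

end Hadamard

/-! ## 5. Theorem 1: the MacWilliams identity -/

section Identity

variable {R : Type*} [CommRing R]

/-- The weight monomial as a product over coordinates:
`x^{n - wt v} y^{wt v} = ∏_i x^{1 - v_i} y^{v_i}`. [cite: MacWilliamsSloane1977, Ch. 5 §2 eq. (10)] -/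
theorem weightMonomial_eq_prod (x y : R) (v : Fin n → Bool) :
    x ^ (n - wt v) * y ^ wt v = ∏ i, if v i = true then y else x := by
  rw [Finset.prod_ite, prod_const, prod_const, card_filter_not_eq_sub_wt, mul_comm]
  rfl

/-- `(-1)^{u·v}` cast into `R` as a product over coordinates.
[cite: MacWilliamsSloane1977, Ch. 5 §2 eq. (10)] -/
theorem cast_dotSign_eq_prod (u v : Fin n → Bool) :
    ((dotSign u v : ℤ) : R) = ∏ i, if (u i && v i) = true then (-1 : R) else 1 := by
  rw [dotSign_eq_prod, Int.cast_prod]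
  exact prod_congr rfl fun i _ => by split_ifs <;> simp

/-- **Eq. (11):** the Hadamard transform of `f(v) = x^{n - wt v} y^{wt v}` is
`f̂(u) = (x + y)^{n - wt u} (x - y)^{wt u}` (the sum over `v ∈ F^n` factors over the coordinates,
each factor being `x + y` if `u_i = 0` and `x - y` if `u_i = 1`).
[cite: MacWilliamsSloane1977, Ch. 5 §2 eqs. (9)–(11)] -/
theorem hadamardTransform_weightMonomial (x y : R) (u : Fin n → Bool) :
    hadamardTransform (fun v => x ^ (n - wt v) * y ^ wt v) u
      = (x + y) ^ (n - wt u) * (x - y) ^ wt u := by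
  unfold hadamardTransform
  simp_rw [zsmul_eq_mul, cast_dotSign_eq_prod, weightMonomial_eq_prod, ← prod_mul_distrib]
  -- interchange: `Σ_{v ∈ F^n} ∏_i g_i(v_i) = ∏_i Σ_{b ∈ F} g_i(b)`
  have hswap := Finset.prod_univ_sum (fun _ : Fin n => (univ : Finset Bool))
    (fun i b => (if (u i && b) = true then (-1 : R) else 1) * (if b = true then y else x))
  rw [Fintype.piFinset_univ] at hswap
  rw [← hswap]
  have hcoord : ∀ i : Fin n,
      (∑ b ∈ (univ : Finset Bool), (if (u i && b) = true then (-1 : R) else 1) *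
        (if b = true then y else x)) = if u i = true then x - y else x + y := by
    intro i
    rw [show (univ : Finset Bool) = {true, false} from rfl, sum_pair (by decide)]
    cases u i <;> simp <;> ring
  -- (the right-hand side was rewritten to `∏_i (if u_i then x - y else x + y)` as well)
  simp_rw [hcoord]

/-- **MacWilliams identity** (Theorem 1, in the form (6), cleared of the denominator): for a binary
linear code `C` of length `n` and elements `x, y` of any commutative ring,
`|C| · Σ_{v ∈ C⊥} x^{n - wt v} y^{wt v} = Σ_{u ∈ C} (x + y)^{n - wt u} (x - y)^{wt u}`,
i.e. `W_{C⊥}(x, y) = |C|⁻¹ W_C(x + y, x - y)`.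
[cite: MacWilliamsSloane1977, Ch. 5 §2 Thm. 1, eqs. (4), (6)] -/
theorem macwilliams_identity {C : Finset (Fin n → Bool)} (hC : IsLinearCode C) (x y : R) :
    (#C : R) * ∑ v ∈ perpCode C, x ^ (n - wt v) * y ^ wt v
      = ∑ u ∈ C, (x + y) ^ (n - wt u) * (x - y) ^ wt u := by
  have h := sum_hadamardTransform_eq hC (fun v => x ^ (n - wt v) * y ^ wt v)
  simp only [hadamardTransform_weightMonomial] at h
  rw [h, zsmul_eq_mul, Int.cast_natCast]

/-- **MacWilliams identity, weight-distribution form** (eq. (5), cleared of the denominator):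
`|C| · Σ_k A'_k x^{n-k} y^k = Σ_i A_i (x + y)^{n-i} (x - y)^i`, where `A_i`, `A'_k` are the weight
distributions of `C` and `C⊥`. [cite: MacWilliamsSloane1977, Ch. 5 §2 Thm. 1, eq. (5)] -/
theorem macwilliams_identity_weightCount {C : Finset (Fin n → Bool)} (hC : IsLinearCode C)
    (x y : R) :
    (#C : R) * ∑ k ∈ range (n + 1), (weightCount (perpCode C) k : R) * (x ^ (n - k) * y ^ k)
      = ∑ i ∈ range (n + 1), (weightCount C i : R) * ((x + y) ^ (n - i) * (x - y) ^ i) := by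
  have h1 := sum_eq_sum_weightCount (perpCode C) (fun k => x ^ (n - k) * y ^ k)
  have h2 := sum_eq_sum_weightCount C (fun i => (x + y) ^ (n - i) * (x - y) ^ i)
  simp only [nsmul_eq_mul] at h1 h2
  rw [← h1, ← h2]
  exact macwilliams_identity hC x y

end Identity

/-! ## 6. The Krawtchouk form (13) -/

/-- The indicator word `1_S` of a support `S ⊆ [n]`. [cite: MacWilliamsSloane1977, Ch. 5 §2 eq. (1)] -/
def indWord (S : Finset (Fin n)) : Fin n → Bool := fun i => decide (i ∈ S)

/-- `supp 1_S = S`. [cite: MacWilliamsSloane1977, Ch. 5 §2 eq. (1)] -/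
theorem filter_indWord (S : Finset (Fin n)) : (univ.filter fun i => indWord S i = true) = S := by
  ext i
  simp [indWord]

/-- `1_{supp v} = v`. [cite: MacWilliamsSloane1977, Ch. 5 §2 eq. (1)] -/
theorem indWord_filter (v : Fin n → Bool) : indWord (univ.filter fun i => v i = true) = v := by
  funext i
  simp [indWord]

/-- `wt 1_S = |S|`. [cite: MacWilliamsSloane1977, Ch. 5 §2 eq. (1)] -/
theorem wt_indWord (S : Finset (Fin n)) : wt (indWord S) = #S :=
  congrArg Finset.card (filter_indWord S)

/-- `(-1)^{1_S · v} = χ_S(v)`. [cite: MacWilliamsSloane1977, Ch. 5 §2 eq. (7); Ch. 5 §3 eq. (27)] -/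
theorem dotSign_indWord (S : Finset (Fin n)) (v : Fin n → Bool) :
    dotSign (indWord S) v = signChar S v := by
  unfold dotSign
  rw [filter_indWord]

/-- **Krawtchouk sums over a linear code:** `Σ_{u ∈ C} K_k(wt u) = |C| · A'_k`, where `A'_k` is
the number of dual codewords of weight `k` (expand `K_k(wt u) = Σ_{|S| = k} χ_S(u)` by Delsarte's
lemma and apply the orthogonality relation to each `v = 1_S`).
[cite: MacWilliamsSloane1977, Ch. 5 §2 eqs. (12), (13)] -/
theorem sum_krawtchouk_wt_eq {C : Finset (Fin n → Bool)} (hC : IsLinearCode C) (k : ℕ) :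
    ∑ u ∈ C, krawtchouk n k (wt u) = (#C : ℤ) * weightCount (perpCode C) k := by
  have step1 : ∑ u ∈ C, krawtchouk n k (wt u)
      = ∑ S ∈ powersetCard k (univ : Finset (Fin n)), ∑ u ∈ C, dotSign u (indWord S) := by
    unfold wt
    simp_rw [← sum_signChar_eq_krawtchouk]
    rw [sum_comm]
    refine sum_congr rfl fun S _ => sum_congr rfl fun u _ => ?_
    rw [dotSign_comm, dotSign_indWord]
  rw [step1]
  simp_rw [sum_dotSign_eq hC]
  rw [← Finset.sum_filter, sum_const, nsmul_eq_mul, mul_comm]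
  congr 1
  -- `#{S : |S| = k, 1_S ∈ C⊥} = #{v ∈ C⊥ : wt v = k}` via `S ↦ 1_S`, `v ↦ supp v`
  unfold weightCount
  exact_mod_cast Finset.card_bij' (fun S _ => indWord S)
    (fun v _ => univ.filter fun i => v i = true)
    (fun S hS => by
      rw [mem_filter] at hS ⊢
      exact ⟨hS.2, by rw [wt_indWord]; exact (mem_powersetCard.mp hS.1).2⟩)
    (fun v hv => by
      rw [mem_filter] at hv ⊢
      exact ⟨mem_powersetCard.mpr ⟨subset_univ _, hv.2⟩, by rw [indWord_filter]; exact hv.1⟩)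
    (fun S _ => filter_indWord S) (fun v _ => indWord_filter v)

/-- **MacWilliams identity, Krawtchouk form** (eq. (13), cleared of the denominator):
`|C| · A'_k = Σ_{i=0}^{n} A_i K_k(i)`. [cite: MacWilliamsSloane1977, Ch. 5 §2 eq. (13)] -/
theorem card_mul_weightCount_perpCode_eq {C : Finset (Fin n → Bool)} (hC : IsLinearCode C)
    (k : ℕ) :
    (#C : ℤ) * weightCount (perpCode C) k
      = ∑ i ∈ range (n + 1), (weightCount C i : ℤ) * krawtchouk n k i := by
  rw [← sum_krawtchouk_wt_eq hC k, sum_eq_sum_weightCount C (fun i => krawtchouk n k i)]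
  simp

/-! ## 7. Corollaries: `|C| · |C⊥| = 2^n` and `(C⊥)⊥ = C` -/

/-- **`|C| · |C⊥| = 2^n`** for a binary linear code of length `n` (Theorem 1 at `x = y = 1`: only
the zero codeword contributes to the right-hand side); i.e. `dim C⊥ = n - dim C`.
[cite: MacWilliamsSloane1977, Ch. 1 §8 ("`C⊥` is an [n, n-k] code"); Ch. 5 §2 Thm. 1] -/
theorem card_mul_card_perpCode {C : Finset (Fin n → Bool)} (hC : IsLinearCode C) :
    #C * #(perpCode C) = 2 ^ n := by
  have h := macwilliams_identity hC (R := ℤ) 1 1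
  simp only [one_pow, mul_one, sum_const, nsmul_eq_mul, sub_self] at h
  have hterm : ∀ u : Fin n → Bool,
      ((1 : ℤ) + 1) ^ (n - wt u) * 0 ^ wt u = if u = (fun _ => false) then 2 ^ n else 0 := by
    intro u
    by_cases hu : u = fun _ => false
    · subst hu
      have h0 : wt (fun _ : Fin n => false) = 0 := (wt_eq_zero_iff _).mpr rfl
      rw [if_pos rfl, h0]
      norm_num
    · have hw : wt u ≠ 0 := fun h0 => hu ((wt_eq_zero_iff u).mp h0)
      rw [zero_pow hw, mul_zero, if_neg hu]
  rw [sum_congr rfl (fun u _ => hterm u), sum_ite_eq' C, if_pos hC.zero_mem] at h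
  exact_mod_cast h

/-- **`(C⊥)⊥ = C`** for a binary linear code (from `C ⊆ (C⊥)⊥` and
`|C| · |C⊥| = 2^n = |C⊥| · |(C⊥)⊥|`). [cite: MacWilliamsSloane1977, Ch. 1 §8 Problem (33)(a)] -/
theorem perpCode_perpCode {C : Finset (Fin n → Bool)} (hC : IsLinearCode C) :
    perpCode (perpCode C) = C := by
  symm
  refine Finset.eq_of_subset_of_card_le (subset_perpCode_perpCode C) ?_
  have h1 := card_mul_card_perpCode hC
  have h2 := card_mul_card_perpCode (isLinearCode_perpCode C)
  have hpos : 0 < #(perpCode C) := card_pos.mpr ⟨_, zero_mem_perpCode C⟩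
  have h3 : #(perpCode (perpCode C)) * #(perpCode C) = #C * #(perpCode C) := by
    rw [mul_comm, h2, h1]
  exact (Nat.eq_of_mul_eq_mul_right hpos h3).le

/-! ## 8. Worked example: the self-dual code `{00, 11}` -/

/-- The repetition code `C₂ = {00, 11}` of length `2`.
[cite: MacWilliamsSloane1977, Ch. 5 §2 Example (ii)] -/
def repCode₂ : Finset (Fin 2 → Bool) := {fun _ => false, fun _ => true}

/-- `C₂` is a linear code. [cite: MacWilliamsSloane1977, Ch. 5 §2 Example (ii)] -/
theorem isLinearCode_repCode₂ : IsLinearCode repCode₂ := by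
  unfold IsLinearCode repCode₂
  decide

/-- `C₂` is self-dual: `C₂⊥ = C₂`. [cite: MacWilliamsSloane1977, Ch. 5 §2 Example (ii); Ch. 1 §8] -/
theorem perpCode_repCode₂ : perpCode repCode₂ = repCode₂ := by
  unfold perpCode repCode₂
  decide

/-- Its weight enumerator `W_{C₂}(x, y) = x² + y²` is fixed by the MacWilliams transform:
`2 (x² + y²) = (x + y)² + (x - y)²`. [cite: MacWilliamsSloane1977, Ch. 5 §2 Example (ii)] -/
example (x y : ℤ) : 2 * (x ^ 2 + y ^ 2) = (x + y) ^ 2 + (x - y) ^ 2 := by ring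

end Literature.InformationTheory.Coding
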